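import Summits.MatrixMultiplication.MatrixMultiplication.Theorems.SaturationLadderXPerfectFamily
import Summits.MatrixMultiplication.MatrixMultiplication.Theorems.FarEdgeDescentNearEdgeCut

/-!
# `α ≥ 2/7` unconditionally, and the named-fact-free grades of the `SaturationLadder` ladders
(route `SaturationLadder`, decomposition cell `decomp-mm`, lens 1 «grading / quantitative ladder», generation 20)

PROOF, 0 sorry, no new definitions, no named facts.  The lens question of this generation is asked in TREE
currency: on each graded family of the cut, where do the SORRY-FREE, NAMED-FACT-FREE theorems of the tree stop?

* §1 **The `α`-ladder** `A_t : ω(1, t, 1) = 2` (`ω = 2 ⟺ ∀ t ≤ 1, A_t`, `summit_iff_forall_thin_one`;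
  `α = sup {t : A_t}`).  In print the frontier is `α ≥ 0.321334` (Vassilevska Williams–Xu–Xu–Zhou 2024) — in the
  tree a NAMED FACT `vxxz2024_alpha_ge`, whose published certificate was audited exactly-infeasible at `ω' = 2`
  (`RectangularExponentAlphaCert.lean`: it certifies `ω(1, 0.321334, 1) ≤ 2 + 1.44·10⁻⁹`, no exact-`2` row); the
  tree's best PROVED bound was Coppersmith's 1982 `α > 0.1722` (`coppersmith1982_dualExponentAlpha_gt`).
  Here: **`2/7 ≤ α(ℂ)`** (`twoSevenths_le_dualExponentAlpha`; `2/7 = 0.285714…`), hence — `α(K) = α(ℚ)` in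
  characteristic `0`, `dualExponentAlpha_eq_rat` — for every such field, `ω(1, t, 1) = 2` for all `t ≤ 2/7`, and **`ω(7, 2, 7) = 14`: `⟨n⁷, n², n⁷⟩` is exactly tight** (`omegaRect_seven_two_seven`).  The proof
  is the `α`-fold (lens 2's `FarEdgeDescentCornerFold.tight_fold`: `T(t,r) ⟹ α ≥ 2t/(1+r)`, i.e.
  `ω(1+r, 2t, 1+r) ≤ ω(1,t,r) + ω(r,t,1) = 2(1+r)`) of this lineage's unconditional exact point
  `T(1/3, 4/3)` (`ω(3,1,4) = 7`, the level-1 X-perfect `CW_7` certificate `4⁴·5⁵ ≤ 7⁷` of generation 18):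
  `2·(1/3)/(1 + 4/3) = 2/7`.  Along the whole typed two-parameter X-perfect family `T(b/a, c/a)`, `a + c = qb`,
  the fold price is `2b/(a+c) = 2/q` (`foldPrice_xPerfect`), and the entropy condition
  `(a+b)^{a+b}(b+c)^{b+c} ≤ b^{(q+2)b} q^{qb}` has no solution for `q ≤ 6` (`(q+2)^{q+2} > 2^{q+2} q^q` there,
  e.g. `8⁸ = 16777216 > 11943936 = 2⁸·6⁶`), so **`2/7` is exactly the `α`-content of the typed family**; the
  symmetric member `(q,a,b,c) = (7,7,2,7)` (`9⁹ = 387420489 ≤ 421654016 = 2⁹·7⁷`) is `ω(7,2,7) = 14` directly.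
* §2 **The `E₂`-chord ladder** `R_t : ω(1, t, 1+t) ≤ 2 + t` (generations 18–19: frontier `0.3465` typed and
  `0.3504` level-2, both MODULO the named fact `α ≥ 0.321334`).  Named-fact-free: **`R_t` for every
  `0 ≤ t ≤ 1/3`** (`chordRung_frontier_unconditional`: `R_{1/3}` is `T(1/3, 4/3)` itself, then down-closure
  along the chord, `chordRung_anti`); the anchored-chord method from the proved anchor `(2/7, 1)` through
  `T(1/3, 4/3)` meets the chord again exactly at `t = 1/3` (`anchoredTop_twoSevenths`), and through the other
  typed points (`T(2/5, 11/5)`, `T(8/19, 45/19)`, `T(1/2, 9/2)`) below it (`0.3158`, `0.3171`, `0.3044`), so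
  `1/3` is the named-fact-free frontier of everything typed so far; its prices (`chordRung_prices`) are
  `α ≥ 2/7` (again) and `ω ≤ 21/8`.
* §3 **Far-quadrant saturation, unconditionally from `7/2` on**: `ω(1, x, y) = x + y` for all `x, y ≥ 7/2`
  (`farQuadrant_saturated_sevenHalves`; lens 2's `farQuadrant_saturated` needs `1/x ≤ α`: the proved quadrant
  grows from `[5.81, ∞)²` (Coppersmith 1982) to `[3.5, ∞)²`; in print `[3.11, ∞)²`).

Ladder census in three currencies (print / tree-named-fact / tree-proved), this generation's column last:
`α`-ladder `0.321334 / 0.321334 / 0.1722 → 2/7`; `E₂`-chord ladder `— / 0.3504 (level 2, modulo layer T) /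
1/3`; the next PROVABLE `α`-grades in class are level-1 `CW_q` designs outside the typed X-perfect family
(all six patterns, asymmetric accounting: `≈ 0.288`; pooled entropy across `CW_6` and `CW_7` blocks:
`≈ 0.293`, cell memo `NODE-SaturationLadder-g20.md` §2) — each one Schönhage certificate away, none typed here.

References: Coppersmith 1982 [Coppersmith1982]; Coppersmith–Winograd 1990 §6 [CoppersmithWinograd1990];
Le Gall 2012 §1 [LeGall2012]; Lotti–Romani 1983 [LottiRomani1983]; Huang–Pan 1998 §2 (2.8) [HuangPan1998];
Bürgisser–Clausen–Shokrollahi 1997, Cor. 15.18 [BurgisserClausenShokrollahi1997];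
Vassilevska Williams–Xu–Xu–Zhou 2024 [VassilevskaWilliamsXuXuZhou2024].
-/

set_option linter.dupNamespace false
-- (single-conjunct summit: the namespace repeats `MatrixMultiplication`)

noncomputable section

namespace Summit.MatrixMultiplication.MatrixMultiplication.Theorems.SaturationLadderAlphaTwoSevenths

open Literature.Computability.AlgebraicComplexity
open Summit.MatrixMultiplication.MatrixMultiplication.Theorems.SaturationLadderXPerfect
  (tight_third_fourThirds tight_twoFifths tight_eight_nineteenths)
open Summit.MatrixMultiplication.MatrixMultiplication.Theorems.SaturationLadderChordLadder
  (chordRung_anti chordRung_of_anchor chordRung_prices tight_half_nineHalves)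
open Summit.MatrixMultiplication.MatrixMultiplication.Theorems.FarEdgeDescentCornerFold (tight_fold)
open Summit.MatrixMultiplication.MatrixMultiplication.Theorems.FarEdgeDescentNearEdgeCut
  (farQuadrant_saturated farQuadrant_saturated')

/-! ## §1 The `α`-ladder: `2/7 ≤ α`, sorry-free -/

/-- **`α ≥ 2/7` unconditionally**: the `α`-fold `T(t,r) ⟹ α ≥ 2t/(1+r)` of the exact point `T(1/3, 4/3)`
(`ω(3,1,4) = 7`, level-1 X-perfect `CW_7`, integer certificate `4⁴·5⁵ ≤ 7⁷`).  Improves the tree's proved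
`α > 0.1722` (Coppersmith 1982); below the printed `0.321334`, which stays a named fact.
[cite: CoppersmithWinograd1990, §6] [cite: LeGall2012, §1] -/
theorem twoSevenths_le_dualExponentAlpha : (2 / 7 : ℝ) ≤ dualExponentAlpha ℂ := by
  have h := tight_fold (by norm_num : (0 : ℝ) ≤ 1 / 3) (by norm_num : (0 : ℝ) ≤ 4 / 3) tight_third_fourThirds
  norm_num at h
  exact h

/-- `0.2857 < α` (decimal form, for citation next to `coppersmith1982_dualExponentAlpha_gt : 0.1722 < α`).
[cite: LeGall2012, §1] -/
theorem dualExponentAlpha_gt_02857 : (0.2857 : ℝ) < dualExponentAlpha ℂ :=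
  lt_of_lt_of_le (by norm_num) twoSevenths_le_dualExponentAlpha

/-- **The rungs `A_t : ω(1, t, 1) = 2` hold for every `t ≤ 2/7`.** [cite: LeGall2012, §1] -/
theorem omegaRect_one_mid_one_eq_two {t : ℝ} (ht : t ≤ 2 / 7) : omegaRect ℂ 1 t 1 = 2 :=
  omegaRect_eq_two_of_le_dualExponentAlpha ℂ (ht.trans twoSevenths_le_dualExponentAlpha)

/-- **`ω(7, 2, 7) = 14`: `⟨n⁷, n², n⁷⟩` is exactly tight** (homogeneity `×7` of `ω(1, 2/7, 1) = 2`; it is also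
the symmetric member `(q,a,b,c) = (7,7,2,7)` of the X-perfect family, certificate `9⁹ ≤ 2⁹·7⁷`).
[cite: LottiRomani1983, §1 (p. 173)] [cite: HuangPan1998, §2 eq. (2.8) (p. 262)] -/
theorem omegaRect_seven_two_seven : omegaRect ℂ 7 2 7 = 14 := by
  have h2 := omegaRect_one_mid_one_eq_two (le_refl (2 / 7 : ℝ))
  have hhom := LottiRomani1983_homogeneous ℂ (by norm_num : (0 : ℝ) ≤ 7) zero_le_one
    (by norm_num : (0 : ℝ) ≤ 2 / 7) zero_le_one
  rw [show (7 : ℝ) * 1 = 7 by norm_num, show (7 : ℝ) * (2 / 7) = 2 by norm_num] at hhom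
  rw [hhom, h2]
  norm_num

/-- **The fold price of the whole typed family is `2/q`**: for a member `T(b/a, c/a)` with `a + c = qb`
(`a, b > 0`), `2(b/a)/(1 + c/a) = 2/q`; so every typed member prices `α` at `2/q ≤ 2/7` (`q ≥ 7` is forced by
the entropy condition). [folklore] -/
theorem foldPrice_xPerfect {q a b c : ℕ} (ha : 0 < a) (hb : 0 < b) (hqb : q * b = a + c) :
    2 * ((b : ℝ) / a) / (1 + (c : ℝ) / a) = 2 / q := by
  have ha' : (0 : ℝ) < a := by exact_mod_cast ha
  have hb' : (0 : ℝ) < b := by exact_mod_cast hb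
  have hqb' : (q : ℝ) * b = a + c := by exact_mod_cast hqb
  have hq : 0 < q := Nat.pos_of_ne_zero (by rintro rfl; simp at hqb; omega)
  have hq' : (0 : ℝ) < q := by exact_mod_cast hq
  rw [show 1 + (c : ℝ) / a = ((a : ℝ) + c) / a by field_simp, ← hqb']
  field_simp

/-- The entropy condition of the family fails at `q = 6` even for its best-placed (symmetric) members:
`8⁸ > 2⁸·6⁶`, i.e. `2η(1/8) + η(3/4) > log 2 ≥ h(p)` — there is no typed member with fold price `1/3`.
[folklore] -/
theorem entropyCondition_fails_six (p : ℝ) :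
    Real.binEntropy p <
      2 * Real.negMulLog (1 / (((6 : ℕ) : ℝ) + 2)) + Real.negMulLog (1 - 2 * (1 / (((6 : ℕ) : ℝ) + 2))) := by
  have key : 8 * Real.log 2 + 6 * Real.log 6 < 8 * Real.log 8 := by
    have h := Real.log_lt_log (by norm_num : (0 : ℝ) < 2 ^ 8 * 6 ^ 6)
      (by norm_num : (2 : ℝ) ^ 8 * 6 ^ 6 < 8 ^ 8)
    rw [Real.log_mul (by norm_num) (by norm_num), Real.log_pow, Real.log_pow, Real.log_pow] at h
    push_cast at h
    linarith
  have e0 : (1 : ℝ) / (((6 : ℕ) : ℝ) + 2) = 1 / 8 := by norm_num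
  rw [e0, show (1 : ℝ) - 2 * (1 / 8) = 6 / 8 by norm_num]
  refine lt_of_le_of_lt (Real.binEntropy_le_log_two (p := p)) ?_
  simp only [Real.negMulLog]
  rw [Real.log_div (by norm_num) (by norm_num), Real.log_div (by norm_num) (by norm_num), Real.log_one]
  linarith

/-! ## §2 The `E₂`-chord ladder: named-fact-free up to `1/3` -/

/-- `R_{1/3}` is the typed exact point `T(1/3, 4/3)` (`ω(3,1,4) = 7`). [cite: LottiRomani1983, §1 (p. 173)] -/
theorem chordRung_third : omegaRect ℂ 1 (1 / 3) (1 + 1 / 3) ≤ 2 + 1 / 3 := by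
  have h := tight_third_fourThirds
  norm_num at h ⊢
  exact h

/-- **FRONTIER, named-fact-free**: the chord rungs `R_t : ω(1, t, 1+t) ≤ 2 + t` hold for every `0 ≤ t ≤ 1/3`
with no hypothesis (generations 18–19 reached `0.3465` / `0.3504` modulo `α ≥ 0.321334`).
[cite: LottiRomani1983, §1 (p. 173)] -/
theorem chordRung_frontier_unconditional {t : ℝ} (ht0 : 0 ≤ t) (ht : t ≤ 1 / 3) :
    omegaRect ℂ 1 t (1 + t) ≤ 2 + t :=
  chordRung_anti ht0 ht chordRung_third

/-- The anchored-chord method from the PROVED anchor `(2/7, 1)`: through `T(1/3, 4/3)` (slope `7`) it reaches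
the chord `r = 1 + t` exactly at `t = (2/7)·7/6 = 1/3`; through `T(2/5, 11/5)`, `T(8/19, 45/19)`, `T(1/2, 9/2)`
(slopes `21/2`, `91/9`, `49/3`) only at `6/19 = 0.3157…`, `26/82 = 0.3170…`, `14/46 = 0.3043…` — all below `1/3`.
[cite: LottiRomani1983, §1 (p. 173)] -/
theorem anchoredTop_twoSevenths :
    (2 / 7 : ℝ) * 7 / (7 - 1) = 1 / 3 ∧ (2 / 7 : ℝ) * (21 / 2) / (21 / 2 - 1) < 1 / 3 ∧
      (2 / 7 : ℝ) * (91 / 9) / (91 / 9 - 1) < 1 / 3 ∧ (2 / 7 : ℝ) * (49 / 3) / (49 / 3 - 1) < 1 / 3 := by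
  refine ⟨by norm_num, by norm_num, by norm_num, by norm_num⟩

/-- The same rungs obtained through `chordRung_of_anchor` from the proved anchor (a consistency check of the
method at `α' = 2/7`: the slope condition `(4/3 − 1)(t − 2/7) ≤ t (1/3 − 2/7)` is `t ≤ 1/3`).
[cite: LottiRomani1983, §1 (p. 173)] -/
theorem chordRung_of_provedAnchor {t : ℝ} (hαt : 2 / 7 ≤ t) (ht : t ≤ 1 / 3) :
    omegaRect ℂ 1 t (1 + t) ≤ 2 + t := by
  have hanchor : omegaRect ℂ 1 (2 / 7) 1 ≤ 2 := (omegaRect_one_mid_one_eq_two le_rfl).le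
  exact chordRung_of_anchor (by norm_num) hanchor (by norm_num : (2 / 7 : ℝ) < 1 / 3) (by norm_num)
    tight_third_fourThirds hαt ht (by linarith)

/-- **Prices at the named-fact-free top `t = 1/3`**: `α ≥ 2/7` (the fold again) and `ω ≤ 21/8 = 2.625` —
consequence-free. [cite: LeGall2012, §1] -/
theorem prices_third : 2 / 7 ≤ dualExponentAlpha ℂ ∧ omega ℂ ≤ 21 / 8 := by
  have h := chordRung_prices (by norm_num : (0 : ℝ) ≤ 1 / 3) chordRung_third
  norm_num at h
  exact h

/-! ## §3 Far-quadrant saturation from `7/2` on -/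

/-- **`ω(1, x, y) = x + y` for all `x, y ≥ 7/2`, unconditionally** (lens 2's far-quadrant saturation needs
`1/x ≤ α`; with `α ≥ 2/7` the proved quadrant starts at `7/2`). [cite: LeGall2012, §1]
[cite: LottiRomani1983, §1 (p. 173)] -/
theorem farQuadrant_saturated_sevenHalves {x y : ℝ} (hx : 7 / 2 ≤ x) (hy : 7 / 2 ≤ y) :
    omegaRect ℂ 1 x y = x + y := by
  have hα := twoSevenths_le_dualExponentAlpha
  have hx' : x⁻¹ ≤ dualExponentAlpha ℂ :=
    le_trans (le_trans (inv_anti₀ (by norm_num) hx) (by norm_num)) hα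
  have hy' : y⁻¹ ≤ dualExponentAlpha ℂ :=
    le_trans (le_trans (inv_anti₀ (by norm_num) hy) (by norm_num)) hα
  rcases le_total x y with hxy | hyx
  · exact farQuadrant_saturated (by linarith) hx' hxy
  · exact farQuadrant_saturated' (by linarith) hy' hyx

/-- In particular the far rung at the integer length `7/2 · 2 = 7` of the DIAGONAL: `ω(1, 7/2, 7/2) = 7`, and
`ω(2, 7, 7) = 14` (homogeneity). [cite: LottiRomani1983, §1 (p. 173)] -/
theorem omegaRect_two_seven_seven : omegaRect ℂ 2 7 7 = 14 := by
  have h := farQuadrant_saturated_sevenHalves (le_refl (7 / 2 : ℝ)) le_rfl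
  have hhom := LottiRomani1983_homogeneous ℂ (by norm_num : (0 : ℝ) ≤ 2) zero_le_one
    (by norm_num : (0 : ℝ) ≤ 7 / 2) (by norm_num : (0 : ℝ) ≤ 7 / 2)
  rw [show (2 : ℝ) * 1 = 2 by norm_num, show (2 : ℝ) * (7 / 2) = 7 by norm_num] at hhom
  rw [hhom, h]
  norm_num

end Summit.MatrixMultiplication.MatrixMultiplication.Theorems.SaturationLadderAlphaTwoSevenths

end
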